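import Summits.QuantumFields.QCD.Theorems.SpectralDefectExtinctionWegnerEstimateSketchDefs

/-!
# Stub `stub_portContinuous` of line `Sketch` (skeleton "ResolventCell", gen 2c) for crux
`SpectralDefectExtinction.WegnerEstimate` (item stmt-QuantumFields-8966)

The junk-free port min-functional `badPort R : LinkData → ℝ` of
`Theorems/SpectralDefectExtinctionWegnerEstimateSketchDefs.lean`,
`badPort R w = inf { Σ|J| + (interior residual)² + (face residual)² : m₀ ∈ [−1,0], lam ∈ [−1,1], ‖φ‖² = 1 }`,
is continuous and non-negative:

`stub_portContinuous : ∀ R : ℕ, Continuous (badPort R) ∧ ∀ w, 0 ≤ badPort R w`.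

Non-negativity is the tree lemma `badPort_nonneg`.  Continuity is "the infimum over a COMPACT constraint set
(`[−1,0] × [−1,1] × {unit ℓ²-sphere of the finite-dimensional space PortField R}`) of a JOINTLY continuous
objective is continuous in the parameter" (Mathlib's `IsCompact.continuous_sInf`), the parameter `w` ranging over
the product space `LinkData = (ℤ⁴ × Fin 4 → SU3)`; joint continuity of the objective holds because it is a finite
sum of products of finitely many link entries `(w l) a b`, inverse-link entries, zero-extended field coordinates,
the real parameters `m₀, lam` and constant matrices.

Contents (all in `namespace Summit.QuantumFields.QCD.Cruxes.WegnerEstimate.ResolventCell`):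

1. GENERIC CORE (independent of the definitions file): `continuous_sInf_image_of_isCompact`,
   `continuous_sInf_range_of_compactSpace`, `continuous_iInf_of_compactSpace`, `setOf_exists_and_eq_eq_image`,
   `continuous_sInf_setOf_of_isCompact`, `continuous_sInf_minFunctional` (THE SKELETON'S SHAPE verbatim:
   `w ↦ sInf {r | ∃ (m₀ lam : ℝ) (φ : Φ), a ≤ m₀ ∧ m₀ ≤ b ∧ |lam| ≤ c ∧ N φ = 1 ∧ r = F w m₀ lam φ}` is continuous
   as soon as `{N = 1}` is compact and `F` is jointly continuous), `isCompact_sphere_sum_norm_sq`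
   (`{φ : ι → ℂ | Σ ‖φ i‖² = c}` is compact for finite `ι`), and the `fun_prop` plumbing `continuous_suEntry`,
   `continuous_dite_apply_zero`.
2. PORT INSTANCE: `portContinuous_portVal` / `portContinuous_portVal_apply` (the zero-extension
   `φ ↦ portVal φ` is continuous into the product space `ℤ⁴ → Fin 3 → Fin 4 → ℂ`), `portContinuous_latticeApply`,
   `portContinuous_latticeCurrent` (joint continuity of `Γ₅ D_W v` and of the colour current in mass, links and the
   field `v` with its product topology — only finitely many coordinates are read), `portContinuous_objective`,
   `continuous_badPort`, and the registered `stub_portContinuous`.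
-/

noncomputable section

namespace Summit.QuantumFields.QCD.Cruxes.WegnerEstimate.ResolventCell

open scoped Matrix BigOperators
open Literature.MathematicalPhysics.QuantumLattice Literature.MathematicalPhysics.QuantumFieldTheory
  Literature.Probability.LatticeModels

/-! ### 1. Continuity of an infimum over a compact parameter set -/

/-- **Infimum over a compact set of a jointly continuous function is continuous in the parameter** (compact SET
form; Mathlib's `IsCompact.continuous_sInf` with the uncurried hypothesis spelled out).  No non-emptiness is needed
(`K = ∅` gives the constant `sInf ∅`). -/
theorem continuous_sInf_image_of_isCompact {W E : Type*} [TopologicalSpace W] [TopologicalSpace E]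
    {K : Set E} (hK : IsCompact K) {f : W → E → ℝ} (hf : Continuous fun p : W × E => f p.1 p.2) :
    Continuous fun w => sInf (f w '' K) :=
  hK.continuous_sInf hf

/-- **Compact TYPE form**: for a compact parameter type `K` and jointly continuous `f : W → K → ℝ`,
`w ↦ sInf (Set.range (f w))` is continuous. -/
theorem continuous_sInf_range_of_compactSpace {W K : Type*} [TopologicalSpace W] [TopologicalSpace K]
    [CompactSpace K] (f : W → K → ℝ) (hf : Continuous (Function.uncurry f)) :
    Continuous fun w => sInf (Set.range (f w)) := by
  simpa only [Set.image_univ] using isCompact_univ.continuous_sInf (f := f) hf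

/-- **`iInf` form**: for a compact parameter type `K` and jointly continuous `f : W → K → ℝ`, `w ↦ ⨅ k, f w k` is
continuous. -/
theorem continuous_iInf_of_compactSpace {W K : Type*} [TopologicalSpace W] [TopologicalSpace K]
    [CompactSpace K] (f : W → K → ℝ) (hf : Continuous (Function.uncurry f)) :
    Continuous fun w => ⨅ k, f w k :=
  continuous_sInf_range_of_compactSpace f hf

/-! ### 2. Set-builder infima (the shape in which min-functionals are defined) -/

/-- `{r | ∃ k, P k ∧ r = F k}` is the image of the constraint set `{k | P k}` under `F`. -/
theorem setOf_exists_and_eq_eq_image {E : Type*} (P : E → Prop) (F : E → ℝ) :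
    {r : ℝ | ∃ k, P k ∧ r = F k} = F '' {k | P k} := by
  ext r
  simp only [Set.mem_setOf_eq, Set.mem_image]
  constructor
  · rintro ⟨k, hk, rfl⟩
    exact ⟨k, hk, rfl⟩
  · rintro ⟨k, hk, rfl⟩
    exact ⟨k, hk, rfl⟩

/-- **Set-builder form**: if the constraint set `{k | P k}` is compact and `f` is jointly continuous, then
`w ↦ sInf {r | ∃ k, P k ∧ r = f w k}` is continuous. -/
theorem continuous_sInf_setOf_of_isCompact {W E : Type*} [TopologicalSpace W] [TopologicalSpace E]
    {P : E → Prop} (hP : IsCompact {k | P k}) {f : W → E → ℝ} (hf : Continuous fun p : W × E => f p.1 p.2) :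
    Continuous fun w => sInf {r : ℝ | ∃ k, P k ∧ r = f w k} := by
  have heq : ∀ w, {r : ℝ | ∃ k, P k ∧ r = f w k} = f w '' {k | P k} :=
    fun w => setOf_exists_and_eq_eq_image P (f w)
  simp only [heq]
  exact hP.continuous_sInf hf

/-- **The skeleton's shape, verbatim.**  For a "norm" `N : Φ → ℝ` with COMPACT unit sphere `{N = 1}`, bounds
`a b c : ℝ` and an objective `F : W → ℝ → ℝ → Φ → ℝ` jointly continuous on `W × ℝ × ℝ × Φ`, the min-functional
`w ↦ sInf {r | ∃ (m₀ lam : ℝ) (φ : Φ), a ≤ m₀ ∧ m₀ ≤ b ∧ |lam| ≤ c ∧ N φ = 1 ∧ r = F w m₀ lam φ}` is continuous: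
the constraint set is `[a, b] × closedBall 0 c × {N = 1}`, compact, and the set under the infimum is its image. -/
theorem continuous_sInf_minFunctional {W Φ : Type*} [TopologicalSpace W] [TopologicalSpace Φ] {N : Φ → ℝ}
    (hS : IsCompact {φ : Φ | N φ = 1}) (a b c : ℝ) {F : W → ℝ → ℝ → Φ → ℝ}
    (hF : Continuous fun p : W × ℝ × ℝ × Φ => F p.1 p.2.1 p.2.2.1 p.2.2.2) :
    Continuous fun w =>
      sInf {r : ℝ | ∃ (m₀ lam : ℝ) (φ : Φ), a ≤ m₀ ∧ m₀ ≤ b ∧ |lam| ≤ c ∧ N φ = 1 ∧ r = F w m₀ lam φ} := by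
  have hK : IsCompact (Set.Icc a b ×ˢ Metric.closedBall (0 : ℝ) c ×ˢ {φ : Φ | N φ = 1}) :=
    isCompact_Icc.prod ((isCompact_closedBall _ _).prod hS)
  have heq : ∀ w,
      {r : ℝ | ∃ (m₀ lam : ℝ) (φ : Φ), a ≤ m₀ ∧ m₀ ≤ b ∧ |lam| ≤ c ∧ N φ = 1 ∧ r = F w m₀ lam φ} =
        (fun k : ℝ × ℝ × Φ => F w k.1 k.2.1 k.2.2) ''
          (Set.Icc a b ×ˢ Metric.closedBall (0 : ℝ) c ×ˢ {φ : Φ | N φ = 1}) := by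
    intro w
    ext r
    simp only [Set.mem_setOf_eq, Set.mem_image, Set.mem_prod, Set.mem_Icc, Metric.mem_closedBall,
      Real.dist_eq, sub_zero, Prod.exists]
    constructor
    · rintro ⟨m₀, lam, φ, h1, h2, h3, h4, rfl⟩
      exact ⟨m₀, lam, φ, ⟨⟨h1, h2⟩, h3, h4⟩, rfl⟩
    · rintro ⟨m₀, lam, φ, ⟨⟨h1, h2⟩, h3, h4⟩, rfl⟩
      exact ⟨m₀, lam, φ, h1, h2, h3, h4, rfl⟩
  simp only [heq]
  exact hK.continuous_sInf (f := fun (w : W) (k : ℝ × ℝ × Φ) => F w k.1 k.2.1 k.2.2) hF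

/-! ### 3. Compact unit spheres of finite-dimensional field spaces -/

/-- **The `ℓ²`-sphere of a finite-dimensional field space is compact**: for a finite index type `ι` and any
`c : ℝ`, `{φ : ι → ℂ | Σ_i ‖φ i‖² = c}` is compact — it is closed (a continuous function) and every coordinate
satisfies `‖φ i‖² ≤ c`, i.e. `‖φ‖_sup ≤ √c`, a closed ball of the proper space `ι → ℂ`. -/
theorem isCompact_sphere_sum_norm_sq {ι : Type*} [Fintype ι] (c : ℝ) :
    IsCompact {φ : ι → ℂ | ∑ i, ‖φ i‖ ^ 2 = c} := by
  have hcont : Continuous fun φ : ι → ℂ => ∑ i, ‖φ i‖ ^ 2 := by fun_prop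
  refine (isCompact_closedBall (0 : ι → ℂ) (Real.sqrt c)).of_isClosed_subset
    (isClosed_eq hcont continuous_const) ?_
  intro φ hφ
  have hφ' : ∑ i, ‖φ i‖ ^ 2 = c := hφ
  rw [Metric.mem_closedBall, dist_zero_right, pi_norm_le_iff_of_nonneg (Real.sqrt_nonneg c)]
  intro i
  have hle : ‖φ i‖ ^ 2 ≤ ∑ j, ‖φ j‖ ^ 2 :=
    Finset.single_le_sum (f := fun j => ‖φ j‖ ^ 2) (fun _ _ => by positivity) (Finset.mem_univ i)
  rw [hφ'] at hle
  calc ‖φ i‖ = Real.sqrt (‖φ i‖ ^ 2) := (Real.sqrt_sq (norm_nonneg _)).symm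
    _ ≤ Real.sqrt c := Real.sqrt_le_sqrt hle

/-! ### 4. `fun_prop` plumbing for lattice objectives -/

/-- A matrix entry of a continuously varying `SU(3)` element is continuous (registered for `fun_prop`, which does
not decompose the over-applied coercion `↑(g x) a b` by itself; with this lemma `fun_prop` handles finite sums of
products of link entries, inverse-link entries (`ContinuousInv SU3`), field coordinates and constants). -/
@[fun_prop]
theorem continuous_suEntry {X : Type*} [TopologicalSpace X] {g : X → SU3} (hg : Continuous g) (a b : Fin 3) :
    Continuous fun x => ((g x : SU3) : Matrix (Fin 3) (Fin 3) ℂ) a b :=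
  (continuous_subtype_val.comp hg).matrix_elem a b

/-- Zero-extended coordinates are continuous: `x ↦ if h : P then φ x (j h) else 0` for a continuous family of
fields `φ : X → (ι → ℂ)` and a constant condition `P` (the shape of the port-field accessor `portVal φ y a α`). -/
theorem continuous_dite_apply_zero {X : Type*} [TopologicalSpace X] {ι : Type*} {P : Prop} [Decidable P]
    {φ : X → ι → ℂ} (hφ : Continuous φ) (j : P → ι) :
    Continuous fun x => if h : P then φ x (j h) else 0 := by
  split_ifs with h
  · exact (continuous_apply _).comp hφ
  · exact continuous_const

/-! ### 5. The port instance -/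

/-- The zero-extended field value `portVal φ y a α` depends continuously on the port field `φ`
(instance of `continuous_dite_apply_zero`, registered for `fun_prop`). -/
@[fun_prop]
theorem portContinuous_portVal_apply {X : Type*} [TopologicalSpace X] {R : ℕ} {φ : X → PortField R}
    (hφ : Continuous φ) (y : Fin 4 → ℤ) (a : Fin 3) (α : Fin 4) :
    Continuous fun x => portVal (φ x) y a α := by
  unfold portVal
  exact continuous_dite_apply_zero hφ _

/-- The zero-extension `φ ↦ portVal φ` is continuous into the product space `ℤ⁴ → Fin 3 → Fin 4 → ℂ`
(coordinatewise, by `portContinuous_portVal_apply`). -/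
@[fun_prop]
theorem portContinuous_portVal {X : Type*} [TopologicalSpace X] {R : ℕ} {φ : X → PortField R}
    (hφ : Continuous φ) : Continuous fun x => portVal (φ x) :=
  continuous_pi fun y => continuous_pi fun a => continuous_pi fun α => portContinuous_portVal_apply hφ y a α

/-- **The colour current is jointly continuous** in the link data and the (zero-extended) field, the latter with
its product topology (only the coordinates at `y` and `y + μ̂` are read). -/
@[fun_prop]
theorem portContinuous_latticeCurrent {X : Type*} [TopologicalSpace X] {w : X → LinkData}
    {v : X → (Fin 4 → ℤ) → Fin 3 → Fin 4 → ℂ} (hw : Continuous w) (hv : Continuous v) (y : Fin 4 → ℤ)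
    (μ : Fin 4) (i : Fin 8) : Continuous fun x => latticeCurrent (w x) (v x) y μ i := by
  have h : Continuous fun p : LinkData × ((Fin 4 → ℤ) → Fin 3 → Fin 4 → ℂ) =>
      latticeCurrent p.1 p.2 y μ i := by
    simp only [latticeCurrent, Matrix.mul_apply]
    fun_prop
  -- `have` first: elaborating the composition against the goal would trigger a costly higher-order unification
  have h2 := h.comp₂ hw hv
  exact h2

/-- **`Γ₅ D_W v` is jointly continuous** in the mass, the link data and the (zero-extended) field `v` with its
product topology (only the coordinates at `y` and `y ± μ̂` are read; inverse links through `ContinuousInv SU3`). -/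
@[fun_prop]
theorem portContinuous_latticeApply {X : Type*} [TopologicalSpace X] {m : X → ℝ} {w : X → LinkData}
    {v : X → (Fin 4 → ℤ) → Fin 3 → Fin 4 → ℂ} (hm : Continuous m) (hw : Continuous w) (hv : Continuous v)
    (y : Fin 4 → ℤ) (a : Fin 3) (α : Fin 4) : Continuous fun x => latticeApply (m x) (w x) (v x) y a α := by
  have h : Continuous fun p : ℝ × LinkData × ((Fin 4 → ℤ) → Fin 3 → Fin 4 → ℂ) =>
      latticeApply p.1 p.2.1 p.2.2 y a α := by
    simp only [latticeApply]
    fun_prop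
  have h2 := h.comp₃ hm hw hv
  exact h2

/-- **Joint continuity of the objective**
`(w, m₀, lam, φ) ↦ portCurrentSum R w φ + portInteriorResSq R m₀ lam w φ + portFaceResSq R m₀ lam w φ`. -/
theorem portContinuous_objective (R : ℕ) :
    Continuous fun p : LinkData × ℝ × ℝ × PortField R =>
      portCurrentSum R p.1 p.2.2.2 + portInteriorResSq R p.2.1 p.2.2.1 p.1 p.2.2.2 +
        portFaceResSq R p.2.1 p.2.2.1 p.1 p.2.2.2 := by
  simp only [portCurrentSum, portInteriorResSq, portFaceResSq]
  fun_prop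

/-- **`badPort R` is continuous**: the generic `continuous_sInf_minFunctional` with the compact `ℓ²`-sphere
`isCompact_sphere_sum_norm_sq 1` and the jointly continuous objective `portContinuous_objective R`. -/
theorem continuous_badPort (R : ℕ) : Continuous (badPort R) := by
  unfold badPort
  exact continuous_sInf_minFunctional (isCompact_sphere_sum_norm_sq 1) (-1) 0 1 (portContinuous_objective R)

/-- **Stub `stub_portContinuous`** (registered gen-2c signature, verbatim): the junk-free port min-functional is
continuous (`continuous_badPort`) and non-negative (tree `badPort_nonneg`). -/
theorem stub_portContinuous : ∀ R : ℕ, Continuous (badPort R) ∧ ∀ w, 0 ≤ badPort R w :=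
  fun R => ⟨continuous_badPort R, badPort_nonneg R⟩

end Summit.QuantumFields.QCD.Cruxes.WegnerEstimate.ResolventCell

end
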